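import Summits.HodgeConjecture.HodgeConjecture.Cruxes.BlochSeedDiscOne.HeightTower

/-!
line stmt-HodgeConjecture-18881 Cruxes/BlochSeedDiscOne/Lines/birth.lean 814a6a70c14e831a stub_rung_pad4_seedAt

# ExtHallB136 — B136 is dead as a GRADED CLASS, not only as a block design: no retyping of its letters by unipotent ∕ homogeneous ∕
# extension structure (any Pic⁰ labels, any filtration order) admits a generically injective display; the filtered-robust law SLOPE–HALL
# (hsemireg-alphabet-unipotent-1 g27, block B2 «same ch as sums of line letters but different H⁰ ∕ Ext — do they change Hall?», applied to the audit object of R19.600–605)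

STATUS ∕ SCOPE.  Letter-model arithmetic about `B136` (= `HallB136.B136` = `RotatedPairB136.D`, h = 9; the h = 14 audit object is its shift) only:
Mumford-index bookkeeping and slope inequalities on the letters ≠ sheaves ≠ a monad ≠ a SEED ≠ the kernel of STUB R.  NOTHING here is proved
toward HC ∕ HC_CM ∕ HC_AV ∕ №4 ∕ 26512 ∕ 18881 ∕ H2, nothing re-decides `Nonex 14 199 8` (REFUTED, `RotatedPairB136.not_nonex_fourteen`), and the
geometric chain (E1)–(E6) below is PEN (memo `EXT-HALL-B136-unipotent1-g27.md`); this file kernel-checks its finite inputs (the index table and the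
slope certificates) and proves the one abstract inequality the certificates rely on (`dual_le_sum`).

THE QUESTION.  `HallB136.not_hallUp` refutes a fibrewise-injective display `⊕_P L_σ → ⊕_N L_τ^{⊕n}` for the SPLIT objects.  Block B2 asks what
changes if the same graded letters are assembled differently: `V` any vector bundle with a filtration whose graded pieces are the 64 P-letters
`L_σ ⊗ α_σ` (α arbitrary in Pic⁰), `𝓝` any vector bundle filtered by the N-letters with their multiplicities (8 × hub⁴, 16 × each `τ_k = (ρᵏt)⁴`) —
this contains every ⊠-unipotent ∕ homogeneous retyping (Mukai: iterated extensions of `L_c ⊗ α`'s on one cell) and every cross-cell extension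
retyping; `ch(V)`, `ch(𝓝)` and the class of `𝓝 − V` are those of B136.  H_Hall of the graded letters is NOT a necessary condition for such
objects in general (memo §2: on an elliptic curve `M₁ ⊕ M₂` is a non-split extension of `M₁M₂` by `𝒪` whose graded design fails Hall against
`L ⊕ L`, deg L = 3, while `M₁ ⊕ M₂ ↪ L ⊕ L` generically).  The replacement that IS necessary for filtered objects is a slope count.

THE DICTIONARY (per factor `A_f` an abelian surface; `DepthBoundA4`: letter `(a; x, y)` = class `a·h + β̄·e + β·ē`, `M² = 2(a² − |β|²)`).  For a step
`σ_f → τ_f` with difference class `d = (Δ; dβ)`, `n := Δ² − |dβ|² = χ`: by the Mumford index theorem `H^i(A_f, M_d ⊗ α) ≠ 0` for SOME `α ∈ Pic⁰` iff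
`i = 0`: `d = 0` or (`Δ > 0` and `n ≥ 0`) [`canH0`; `canH0_iff_notDead`: it IS the model's raw `NotDead`, so `homB` is `WeakLive` (`homB_iff_weakLive`)];
`i = 1`: `n ≤ 0` [`canH1`: index-1 classes for every α, degenerate ∕ trivial classes for special α]; `i = 2`: `d = 0` or (`Δ < 0` and `n ≥ 0`).
Künneth on `X = ∏ A_f` with `Pic⁰(X) = ∏ Pic⁰(A_f)`: `Ext^i(L_σ ⊗ α, L_τ ⊗ α′)` can be non-zero only if `i = Σ_f i_f` with `H^{i_f}` possible on
factor `f`; so `homB` ∕ `ext1B` below are UPPER BOUNDS for «Hom ∕ Ext¹ ≠ 0 for some labels» and their negations are vanishing statements for ALL labels.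

THE THEOREM (pen, memo §3; inputs certified here).  Let `(V, 𝓝)` be any filtered retyping of B136 as above and `φ : V → 𝓝` a sheaf map.
(E1) N-SPLIT [`N_split`]: `Ext¹` vanishes between letters on distinct N-cells for all labels (hub ↔ τ: `n = 24 > 0` on every factor, Ext in degree
     0 or 8 only; `τ_k ↔ τ_l`: `n < 0` on every factor, degree 4 only) ⇒ `𝓝 ≅ 𝓝_hub ⊕ ⊕_k 𝓝_{τ_k}`, each `𝓝_c` filtered by `L_c ⊗ α_i`'s.
(E2) P-BLOCKS [`P_blocks`]: Hom = Ext¹ = 0 between letters of different rotated P-blocks (degree 4 only) ⇒ `V ≅ ⊕_k V_k`, `V_k` filtered by block k.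
(E3) BLOCK-DIAGONAL [`block_diag`]: `Hom(L_σ ⊗ α, L_{τ_l} ⊗ α′) = 0` for σ in block k unless `l ≡ k − 1 (mod 4)`, and then only for the all-`p`
     cell `π_k` (inside block k, `Ext^j(σ, τ_{k−1})` lives in degree `j = #q-factors of σ`); by dévissage `V → ⊕_l 𝓝_{τ_l}` is block-diagonal,
     so its rank is `Σ_k r_k`, `r_k :=` generic rank of `φ_k : V_k → 𝓝_{τ_{k−1}}`.
(E4) If `φ` is generically injective then `ker(V → ⊕_l 𝓝_{τ_l})` injects generically into `𝓝_hub` (rank 8), so `Σ_k r_k ≥ 64 − 8 = 56`.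
(E5) SLOPE–HALL: `I_k := φ_k(V_k) ⊂ 𝓝_{τ}` (τ = τ_{k−1}) is torsion-free of rank `r_k`; the filtration of `𝓝_τ` induces one on `I_k` with graded
     pieces rank ≤ 1 subsheaves of the `L_τ ⊗ α_i`, so `c₁(I_k)·H⁷ ≤ r_k·(c₁(L_τ)·H⁷)`; the kernel `K_k ⊂ V_k` (rank `16 − r_k`) likewise has
     `c₁(K_k)·H⁷ ≤` the sum of the `16 − r_k` LARGEST `c₁(L_σ)·H⁷`, σ in block k; `c₁(I_k) = c₁(V_k) − c₁(K_k)`.  Hence for every ample `H`: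
         (sum of the `r_k` SMALLEST `c₁(L_σ)·H⁷` over block k)  ≤  `r_k · c₁(L_τ)·H⁷`.
     For a product class `H = Σ_f pr_f^* u`, `u = (a₀; x₀, y₀)` ample on the factor (`a₀ > 0`, `a₀² > x₀² + y₀²`):
     `c₁(L_cell)·H⁷ = 630·(u²)³·2·Σ_f (a_f a₀ − x_f x₀ − y_f y₀)` = a positive constant × `slope u cell` below.
(E6) [`slope_violations`, `min_subset_sum_gt`]: for every block k and every `7 ≤ r ≤ 16` there is an ample `u` (and a dual threshold `θ`) with
     `r·slope u τ_{k−1} <` every `r`-subset sum of block-k slopes; so `r_k ≤ 6`, `Σ_k r_k ≤ 24 < 56`: NO generically injective `φ` exists.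
     (Pen closed form, memo §3: with `J(r)` = number of `q`-letters among the `r` cells of fewest `q`'s, a violating `u` exists iff `J(r) > r`, i.e. `r ≥ 7`.)
COROLLARIES (memo §4).  (i) Block B2 proper: no ⊠-unipotent ∕ homogeneous retyping of B136 displays injectively (also directly: SPEC §4 Lemma G —
the Hall numbers are alphabet-blind).  (ii) The audit's scope sentence for VERDICT 1 extends from «blocks» to «every object filtered by the B136
letters».  (iii) Hub dial `D_m` (hub multiplicity m, rank m): SLOPE–HALL excludes every retyping for `m < 40`; `40 ≤ m ≤ 59` is the window where split ∕
unipotent retypings are Hall-dead but extension retypings are excluded by neither law (the only non-split structure available at all is INSIDE a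
P-block — none on the N-side by (E1), none across blocks by (E2) — and there `Ext¹(σ, σ′) ≠ 0` needs every moving factor to carry the degenerate class
`±(4;0,−4)`, at most one of them downward, and special labels: `P_within`).  (iv) Everything is invariant under the height shift (differences and
slope differences are), so it holds verbatim for the h = 14 object `shiftD 5 B136`.

`decide +kernel` only, on closed terms; the B136 lists of §2 are VERBATIM `HallB136` §3 (= `RotatedPairB136.D`), re-declared so that this file
imports `HeightTower` only (`HallB136` is not yet in the farm snapshot; `ExtHallB136.DN = HallB136.DN` and `DP = HallB136.DP` are `rfl` once both
are imported, and `B136_copies` repeats its bookkeeping numbers 136 ∕ 8 ∕ 5 ∕ 64).  No `native_decide`, no `sorry`, no `axiom`, no `instance`, no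
notation, no Literature fact, no unsafe option.
-/

set_option linter.dupNamespace false
set_option autoImplicit false
set_option maxRecDepth 8192
set_option maxHeartbeats 4000000

namespace Summit.HodgeConjecture.HodgeConjecture.Cruxes.BlochSeedDiscOne.ExtHallB136

open Summit.HodgeConjecture.HodgeConjecture.Cruxes.BlochSeedDiscOne.DepthBoundA4
open Summit.HodgeConjecture.HodgeConjecture.Cruxes.BlochSeedDiscOne.HeightTower

/-! ## §1 Weak cohomological support of a factor step and the Künneth tests -/

/-- letter equality, componentwise (raw form, as in `HallB136.notDeadB`). -/
def letterEqB (ℓ ℓ' : Letter) : Bool := decide (ℓ.a = ℓ'.a) && decide (ℓ.x = ℓ'.x) && decide (ℓ.y = ℓ'.y)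

theorem letterEqB_iff (ℓ ℓ' : Letter) : letterEqB ℓ ℓ' = true ↔ ℓ = ℓ' := by
  obtain ⟨a, x, y⟩ := ℓ
  obtain ⟨a', x', y'⟩ := ℓ'
  simp [letterEqB, and_assoc]

/-- `n = χ` of the difference class `τ_f − σ_f` (products, not powers: kernel-friendly). -/
def nD (ℓ ℓ' : Letter) : ℤ :=
  (ℓ'.a - ℓ.a) * (ℓ'.a - ℓ.a) - (ℓ'.x - ℓ.x) * (ℓ'.x - ℓ.x) - (ℓ'.y - ℓ.y) * (ℓ'.y - ℓ.y)

/-- `H⁰(M ⊗ α) ≠ 0` for some `α`: equal letters, or `Δa > 0` with `n ≥ 0` (= raw `NotDead`). -/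
def canH0 (ℓ ℓ' : Letter) : Bool := letterEqB ℓ ℓ' || (decide (ℓ.a < ℓ'.a) && decide (0 ≤ nD ℓ ℓ'))

/-- `H¹(M ⊗ α) ≠ 0` for some `α`: `n ≤ 0` (index-1 classes always; degenerate and trivial classes for special `α`). -/
def canH1 (ℓ ℓ' : Letter) : Bool := decide (nD ℓ ℓ' ≤ 0)

/-- all four factors admit `H⁰`: `Hom(L_x ⊗ α, L_y ⊗ α′)` may be non-zero for some labels. -/
def homB (x y : Cell) : Bool :=
  canH0 (x 0) (y 0) && canH0 (x 1) (y 1) && canH0 (x 2) (y 2) && canH0 (x 3) (y 3)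

/-- one factor admits `H¹` and the other three admit `H⁰`: `Ext¹(L_x ⊗ α, L_y ⊗ α′)` may be non-zero for some labels (Künneth). -/
def ext1B (x y : Cell) : Bool :=
  (canH1 (x 0) (y 0) && canH0 (x 1) (y 1) && canH0 (x 2) (y 2) && canH0 (x 3) (y 3)) ||
  (canH0 (x 0) (y 0) && canH1 (x 1) (y 1) && canH0 (x 2) (y 2) && canH0 (x 3) (y 3)) ||
  (canH0 (x 0) (y 0) && canH0 (x 1) (y 1) && canH1 (x 2) (y 2) && canH0 (x 3) (y 3)) ||
  (canH0 (x 0) (y 0) && canH0 (x 1) (y 1) && canH0 (x 2) (y 2) && canH1 (x 3) (y 3))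

/-- letter-by-letter cell equality test. -/
def cellEqB (x y : Cell) : Bool :=
  letterEqB (x 0) (y 0) && letterEqB (x 1) (y 1) && letterEqB (x 2) (y 2) && letterEqB (x 3) (y 3)

/-- every element passes (tail form). -/
def allB {α : Type} : List α → (α → Bool) → Bool
  | [], _ => true
  | x :: l, f => match f x with | true => allB l f | false => false

theorem allB_iff {α : Type} (l : List α) (f : α → Bool) : allB l f = true ↔ ∀ x ∈ l, f x = true := by
  induction l with
  | nil => simp [allB]
  | cons x l ih =>
    simp only [allB, List.mem_cons, forall_eq_or_imp]
    cases hx : f x <;> simp [ih]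

/-- consistency with the model: the weak `H⁰` test IS the raw `NotDead` of `DepthBoundA4`. -/
theorem canH0_iff_notDead (ℓ ℓ' : Letter) : canH0 ℓ ℓ' = true ↔ NotDead ℓ ℓ' := by
  simp only [canH0, nD, NotDead, Bool.or_eq_true, Bool.and_eq_true, decide_eq_true_eq, letterEqB_iff]
  constructor
  · rintro (h | ⟨h1, h2⟩)
    · exact Or.inl h
    · refine Or.inr ⟨h1, ?_⟩
      simp only [pow_two]
      linarith
  · rintro (h | ⟨h1, h2⟩)
    · exact Or.inl h
    · refine Or.inr ⟨h1, ?_⟩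
      simp only [pow_two] at h2
      linarith

/-- hence the Künneth `Hom` test is the model's `WeakLive`. -/
theorem homB_iff_weakLive (x y : Cell) : homB x y = true ↔ WeakLive x y := by
  simp only [homB, Bool.and_eq_true, canH0_iff_notDead, WeakLive]
  constructor
  · rintro ⟨⟨⟨h0, h1⟩, h2⟩, h3⟩ f
    have h4 : ∀ i : Fin 4, i = 0 ∨ i = 1 ∨ i = 2 ∨ i = 3 := by decide
    rcases h4 f with rfl | rfl | rfl | rfl <;> assumption
  · intro h
    exact ⟨⟨⟨h 0, h 1⟩, h 2⟩, h 3⟩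

/-- differences — hence every index test — are invariant under the height shift `shiftL t` of `HeightTower`. -/
theorem nD_shift (t : ℤ) (ℓ ℓ' : Letter) : nD (shiftL t ℓ) (shiftL t ℓ') = nD ℓ ℓ' := by
  simp only [nD, shiftL]
  ring

/-! ## §2 The design `B136` (verbatim `HallB136` §3 = `RotatedPairB136.D`, re-declared so that this file imports `HeightTower` only) and the named cells -/

/-- a cell from four letters. -/
def cellOf (l₀ l₁ l₂ l₃ : Letter) : Cell := fun f =>
  match f with
  | ⟨0, _⟩ => l₀
  | ⟨1, _⟩ => l₁
  | ⟨2, _⟩ => l₂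
  | ⟨_, _⟩ => l₃

/-- level 3: the last slot runs over `u`. -/
def blk3 (u : List (Letter × ℕ)) (a b c : Letter) (m : ℕ) : List (Cell × ℕ) := u.map fun e => (cellOf a b c e.1, m * e.2)
/-- level 2. -/
def blk2 (u : List (Letter × ℕ)) (a b : Letter) (m : ℕ) : List (Cell × ℕ) := u.flatMap fun e => blk3 u a b e.1 (m * e.2)
/-- level 1. -/
def blk1 (u : List (Letter × ℕ)) (a : Letter) (m : ℕ) : List (Cell × ℕ) := u.flatMap fun e => blk2 u a e.1 (m * e.2)
/-- the product block `u^{⊠4}`. -/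
def prod4 (u : List (Letter × ℕ)) : List (Cell × ℕ) := u.flatMap fun e => blk1 u e.1 e.2

/-- the hub cell `(9;0,0)⁴`. -/
def hub4 : Cell := cellOf ⟨9, 0, 0⟩ ⟨9, 0, 0⟩ ⟨9, 0, 0⟩ ⟨9, 0, 0⟩

/-- `u = 2·(2;−4,3)` and its rotations. -/
def uN0 : List (Letter × ℕ) := [(⟨2, -4, 3⟩, 2)]
def uN1 : List (Letter × ℕ) := [(⟨2, -3, -4⟩, 2)]
def uN2 : List (Letter × ℕ) := [(⟨2, 4, -3⟩, 2)]
def uN3 : List (Letter × ℕ) := [(⟨2, 3, 4⟩, 2)]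
/-- `u′ = (0;4,5) + (4;4,1)` and its rotations. -/
def vP0 : List (Letter × ℕ) := [(⟨0, 4, 5⟩, 1), (⟨4, 4, 1⟩, 1)]
def vP1 : List (Letter × ℕ) := [(⟨0, -5, 4⟩, 1), (⟨4, -1, 4⟩, 1)]
def vP2 : List (Letter × ℕ) := [(⟨0, -4, -5⟩, 1), (⟨4, -4, -1⟩, 1)]
def vP3 : List (Letter × ℕ) := [(⟨0, 5, -4⟩, 1), (⟨4, 1, -4⟩, 1)]

/-- N-list: `8·hub⁴`, then the four rotated blocks `(ρᵏ(2;−4,3))⁴` of multiplicity 16. -/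
def DN : List (Cell × ℕ) := (hub4, 8) :: (prod4 uN0 ++ prod4 uN1 ++ prod4 uN2 ++ prod4 uN3)

/-- P-list: the four rotated product blocks of `u′`. -/
def DP : List (Cell × ℕ) := prod4 vP0 ++ prod4 vP1 ++ prod4 vP2 ++ prod4 vP3

/-- the B136 design (= `HallB136.B136` = `RotatedPairB136.D`). -/
def B136 : Design := ⟨DN, DP⟩

/-- bookkeeping (same numbers as `HallB136.B136_copies`): 136 copies, rank 8, 5 + 64 entries. [kernel] -/
theorem B136_copies : B136.copies = 136 ∧ B136.rank = 8 ∧ DN.length = 5 ∧ DP.length = 64 := by decide +kernel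


/-- `τ_k = (ρᵏ t)⁴`, `t = (2;−4,3)`. -/
def tau0 : Cell := cellOf ⟨2, -4, 3⟩ ⟨2, -4, 3⟩ ⟨2, -4, 3⟩ ⟨2, -4, 3⟩
def tau1 : Cell := cellOf ⟨2, -3, -4⟩ ⟨2, -3, -4⟩ ⟨2, -3, -4⟩ ⟨2, -3, -4⟩
def tau2 : Cell := cellOf ⟨2, 4, -3⟩ ⟨2, 4, -3⟩ ⟨2, 4, -3⟩ ⟨2, 4, -3⟩
def tau3 : Cell := cellOf ⟨2, 3, 4⟩ ⟨2, 3, 4⟩ ⟨2, 3, 4⟩ ⟨2, 3, 4⟩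
/-- `π_k = (ρᵏ p)⁴`, `p = (0;4,5)`: the all-`p` cell of block k. -/
def pi0 : Cell := cellOf ⟨0, 4, 5⟩ ⟨0, 4, 5⟩ ⟨0, 4, 5⟩ ⟨0, 4, 5⟩
def pi1 : Cell := cellOf ⟨0, -5, 4⟩ ⟨0, -5, 4⟩ ⟨0, -5, 4⟩ ⟨0, -5, 4⟩
def pi2 : Cell := cellOf ⟨0, -4, -5⟩ ⟨0, -4, -5⟩ ⟨0, -4, -5⟩ ⟨0, -4, -5⟩
def pi3 : Cell := cellOf ⟨0, 5, -4⟩ ⟨0, 5, -4⟩ ⟨0, 5, -4⟩ ⟨0, 5, -4⟩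
/-- the four rotated P-blocks (16 cells of multiplicity 1 each). -/
def B0 : List (Cell × ℕ) := prod4 vP0
def B1 : List (Cell × ℕ) := prod4 vP1
def B2 : List (Cell × ℕ) := prod4 vP2
def B3 : List (Cell × ℕ) := prod4 vP3

theorem DP_eq_blocks : DP = B0 ++ B1 ++ B2 ++ B3 := rfl

/-- N-list bookkeeping: the five entries are (hub⁴, 8), (τ₀, 16), (τ₁, 16), (τ₂, 16), (τ₃, 16), in this order. [kernel] -/
theorem DN_cells : (DN.map fun cn => (cellEqB cn.1 hub4, cellEqB cn.1 tau0, cellEqB cn.1 tau1, cellEqB cn.1 tau2, cellEqB cn.1 tau3, cn.2)) =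
    [(true, false, false, false, false, 8), (false, true, false, false, false, 16), (false, false, true, false, false, 16),
     (false, false, false, true, false, 16), (false, false, false, false, true, 16)] := by decide +kernel

/-- P-list bookkeeping: 4 × 16 entries, all of multiplicity 1; `π_k ∈ B_k`. [kernel] -/
theorem P_blocks_shape : B0.length = 16 ∧ B1.length = 16 ∧ B2.length = 16 ∧ B3.length = 16 ∧
    allB DP (fun cm => decide (cm.2 = 1)) = true ∧
    allB [(B0, pi0), (B1, pi1), (B2, pi2), (B3, pi3)] (fun bp => (bp.1.filter fun cm => cellEqB cm.1 bp.2).length == 1) = true := by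
  decide +kernel

/-! ## §3 (E1) N-SPLIT, (E2) P-BLOCKS, (E3) BLOCK-DIAGONALITY -/

/-- **(E1)** `Ext¹` between letters on distinct N-cells vanishes for every pair of labels. [kernel] -/
theorem N_split : allB DN (fun cn => allB DN (fun cn' => cellEqB cn.1 cn'.1 || !ext1B cn.1 cn'.1)) = true := by decide +kernel

/-- **(E2)** `Hom = Ext¹ = 0` (every label, both directions) between letters of different P-blocks. [kernel] -/
theorem P_blocks : allB [(B0, B1 ++ B2 ++ B3), (B1, B0 ++ B2 ++ B3), (B2, B0 ++ B1 ++ B3), (B3, B0 ++ B1 ++ B2)]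
    (fun bb => allB bb.1 (fun s => allB bb.2 (fun s' =>
      !homB s.1 s'.1 && !ext1B s.1 s'.1 && !homB s'.1 s.1 && !ext1B s'.1 s.1))) = true := by decide +kernel

/-- **(E3)** block k is `Hom`-dead toward `τ_l`, `l ≠ k − 1`, and toward `τ_{k−1}` exactly its all-`p` cell `π_k` is `Hom`-live; every P-cell is
`Hom`-live and `Ext¹`-dead toward the hub. [kernel] -/
theorem block_diag :
    allB B0 (fun s => !homB s.1 tau0 && !homB s.1 tau1 && !homB s.1 tau2 && (homB s.1 tau3 == cellEqB s.1 pi0)) = true ∧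
    allB B1 (fun s => !homB s.1 tau1 && !homB s.1 tau2 && !homB s.1 tau3 && (homB s.1 tau0 == cellEqB s.1 pi1)) = true ∧
    allB B2 (fun s => !homB s.1 tau2 && !homB s.1 tau3 && !homB s.1 tau0 && (homB s.1 tau1 == cellEqB s.1 pi2)) = true ∧
    allB B3 (fun s => !homB s.1 tau3 && !homB s.1 tau0 && !homB s.1 tau1 && (homB s.1 tau2 == cellEqB s.1 pi3)) = true ∧
    allB DP (fun s => homB s.1 hub4 && !ext1B s.1 hub4) = true := by
  decide +kernel

/-- number of `q`-letters (`a = 4`) in a cell. -/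
def qCount (c : Cell) : ℕ :=
  (if (c 0).a = 4 then 1 else 0) + (if (c 1).a = 4 then 1 else 0) + (if (c 2).a = 4 then 1 else 0) + (if (c 3).a = 4 then 1 else 0)

/-- `Ext¹(σ, τ_{k−1})` is possible exactly for the one-`q` cells of block k (degree = number of `q`-factors; record for (E3)). [kernel] -/
theorem ext1_to_tau_iff_one_q :
    allB B0 (fun s => ext1B s.1 tau3 == decide (qCount s.1 = 1)) = true ∧
    allB B1 (fun s => ext1B s.1 tau0 == decide (qCount s.1 = 1)) = true ∧
    allB B2 (fun s => ext1B s.1 tau1 == decide (qCount s.1 = 1)) = true ∧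
    allB B3 (fun s => ext1B s.1 tau2 == decide (qCount s.1 = 1)) = true := by
  decide +kernel

/-- number of factors on which the step `x → y` goes DOWN in `a` (inside a block: a `q → p` factor). -/
def downCount (x y : Cell) : ℕ :=
  (if (y 0).a < (x 0).a then 1 else 0) + (if (y 1).a < (x 1).a then 1 else 0) +
  (if (y 2).a < (x 2).a then 1 else 0) + (if (y 3).a < (x 3).a then 1 else 0)

/-- where non-split P-structure can live: inside each block `Hom(σ, σ′)` is possible (for some labels) iff no factor steps down (`q → p`), and
`Ext¹(σ, σ′)` is possible iff at most one factor steps down; every moving factor carries the degenerate class `±(4;0,−4)` (`n = 0`, special labels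
only) and equal factors contribute `H⁰(𝒪) ∕ H¹(𝒪)`.  (So inside a block extensions are plentiful but only along label-special degenerate steps.) [kernel] -/
theorem P_within : allB [B0, B1, B2, B3] (fun Bk => allB Bk (fun s => allB Bk (fun s' =>
    (homB s.1 s'.1 == decide (downCount s.1 s'.1 = 0)) && (ext1B s.1 s'.1 == decide (downCount s.1 s'.1 ≤ 1))))) = true := by
  decide +kernel

/-! ## §4 (E5)–(E6) SLOPE–HALL: the slope functional, the dual lower bound, the certificates -/

/-- half the intersection pairing on a factor: `(a;x,y)·(a₀;x₀,y₀) = 2(a a₀ − x x₀ − y y₀)`. -/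
def pairL (u ℓ : Letter) : ℤ := ℓ.a * u.a - ℓ.x * u.x - ℓ.y * u.y

/-- `slope u c` ∝ `c₁(L_c)·H⁷` for the product polarization `H = Σ_f pr_f^* u` (positive factor `630·(u²)³·2` dropped). -/
def slope (u : Letter) (c : Cell) : ℤ := pairL u (c 0) + pairL u (c 1) + pairL u (c 2) + pairL u (c 3)

/-- the height shift moves every letter slope by the same amount `t·a₀`, so slope DIFFERENCES (all that (E5)–(E6) use) are shift-invariant:
the certificates below hold verbatim for the h = 14 object `shiftD 5 B136`. -/
theorem pairL_shift (u : Letter) (t : ℤ) (ℓ : Letter) : pairL u (shiftL t ℓ) = pairL u ℓ + t * u.a := by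
  simp only [pairL, shiftL]
  ring

/-- `u` is ample on the factor. -/
def ampleB (u : Letter) : Bool := decide (0 < u.a) && decide (u.x * u.x + u.y * u.y < u.a * u.a)

/-- dual lower bound for the minimum `r`-subset sum of `vals`: `r·θ − Σ max(0, θ − v)`. -/
def dualB (vals : List ℤ) (r : ℕ) (θ : ℤ) : ℤ := (r : ℤ) * θ - (vals.map fun v => max 0 (θ - v)).sum

/-- **the dual bound is sound**: every sub-multiset `R` of `l` has `|R|·θ − Σ_l max(0, θ − v) ≤ Σ_R v`. -/
theorem dual_le_sum (θ : ℤ) {R l : List ℤ} (h : R.Sublist l) : dualB l R.length θ ≤ R.sum := by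
  induction h with
  | slnil => simp [dualB]
  | cons a _ ih =>
    simp only [dualB, List.map_cons, List.sum_cons] at ih ⊢
    have : 0 ≤ max 0 (θ - a) := le_max_left _ _
    linarith
  | cons_cons a _ ih =>
    simp only [dualB, List.map_cons, List.sum_cons, List.length_cons] at ih ⊢
    push_cast
    have : θ - max 0 (θ - a) ≤ a := by
      rcases le_total 0 (θ - a) with h1 | h1
      · rw [max_eq_right h1]; linarith
      · rw [max_eq_left h1]; linarith
    linarith

/-- the SLOPE–HALL certificate for a block `Bk` against a target cell `τ` at rank `r`: an ample `u` and a threshold `θ` with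
`r · slope u τ < dualB (slopes of Bk) r θ`. -/
def slopeCert (Bk : List (Cell × ℕ)) (τ : Cell) (r : ℕ) (u : Letter) (θ : ℤ) : Bool :=
  ampleB u && decide ((r : ℤ) * slope u τ < dualB (Bk.map fun cm => slope u cm.1) r θ)

/-- a certificate excludes rank `r`: EVERY `r`-element sub-multiset of the block has slope sum `> r · slope u τ`. -/
theorem min_subset_sum_gt (Bk : List (Cell × ℕ)) (τ : Cell) (r : ℕ) (u : Letter) (θ : ℤ)
    (hc : slopeCert Bk τ r u θ = true) (R : List (Cell × ℕ)) (hR : R.Sublist Bk) (hlen : R.length = r) :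
    (r : ℤ) * slope u τ < (R.map fun cm => slope u cm.1).sum := by
  simp only [slopeCert, Bool.and_eq_true, decide_eq_true_eq] at hc
  have hsub : (R.map fun cm => slope u cm.1).Sublist (Bk.map fun cm => slope u cm.1) := hR.map _
  have hd := dual_le_sum θ hsub
  rw [List.length_map, hlen] at hd
  exact lt_of_lt_of_le hc.2 hd

/-- **(E6)** for every block `k` and every `7 ≤ r ≤ 16`: an ample product class under which every `r`-subset of block k is too steep for `τ_{k−1}`. [kernel] -/
theorem slope_violations :
    allB [((7 : ℕ), (⟨6, -5, 2⟩ : Letter), (104 : ℤ)), (8, ⟨3, -2, 2⟩, 32), (9, ⟨3, -2, 1⟩, 44), (10, ⟨2, -1, 1⟩, 20), (11, ⟨2, -1, 1⟩, 20),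
          (12, ⟨2, -1, 0⟩, 40), (13, ⟨2, -1, 0⟩, 32), (14, ⟨2, -1, 0⟩, 32), (15, ⟨2, -1, 0⟩, 32), (16, ⟨2, -1, 0⟩, 32)]
      (fun c => slopeCert B0 tau3 c.1 c.2.1 c.2.2) = true ∧
    allB [((7 : ℕ), (⟨6, -3, -5⟩ : Letter), (92 : ℤ)), (8, ⟨3, -2, -2⟩, 32), (9, ⟨3, -2, -2⟩, 32), (10, ⟨2, -1, -1⟩, 20), (11, ⟨2, -1, -1⟩, 20),
          (12, ⟨2, -1, -1⟩, 20), (13, ⟨2, -1, -1⟩, 20), (14, ⟨2, -1, -1⟩, 20), (15, ⟨2, -1, -1⟩, 20), (16, ⟨2, -1, -1⟩, 20)]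
      (fun c => slopeCert B1 tau0 c.1 c.2.1 c.2.2) = true ∧
    allB [((7 : ℕ), (⟨6, 5, -3⟩ : Letter), (92 : ℤ)), (8, ⟨3, 2, -2⟩, 32), (9, ⟨3, 2, -2⟩, 32), (10, ⟨2, 1, -1⟩, 20), (11, ⟨2, 1, -1⟩, 20),
          (12, ⟨2, 1, -1⟩, 20), (13, ⟨2, 0, -1⟩, 16), (14, ⟨2, 0, -1⟩, 16), (15, ⟨2, 0, -1⟩, 16), (16, ⟨2, 0, -1⟩, 16)]
      (fun c => slopeCert B2 tau1 c.1 c.2.1 c.2.2) = true ∧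
    allB [((7 : ℕ), (⟨6, 2, 5⟩ : Letter), (104 : ℤ)), (8, ⟨3, 2, 2⟩, 32), (9, ⟨3, 1, 2⟩, 44), (10, ⟨2, 1, 1⟩, 20), (11, ⟨2, 1, 1⟩, 20),
          (12, ⟨2, 0, 1⟩, 40), (13, ⟨2, 0, 1⟩, 32), (14, ⟨2, 0, 1⟩, 32), (15, ⟨2, 0, 1⟩, 32), (16, ⟨2, 0, 1⟩, 32)]
      (fun c => slopeCert B3 tau2 c.1 c.2.1 c.2.2) = true := by
  decide +kernel

/-- sanity in the other direction: at `r = 6` the split design's own low cells pass the slope count under the `r = 7` witness class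
(the law does not exclude `r_k ≤ 6`; the split display has `r_k = 1`). [kernel] -/
theorem slope_r6_passes : dualB (B0.map fun cm => slope ⟨6, -5, 2⟩ cm.1) 6 104 ≤ 6 * slope ⟨6, -5, 2⟩ tau3 := by decide +kernel

/-! ## §5 The h = 14 audit object `shiftD 5 B136`: the same certificates (differences are shift-invariant; slopes move by `20·a₀` per cell) -/

/-- a list with every cell shifted by 5 on every factor, multiplicities kept. -/
def shB (L : List (Cell × ℕ)) : List (Cell × ℕ) := L.map fun cm => (shiftCell 5 cm.1, cm.2)

/-- the h = 14 object of the audit (`= HallB136.B136h14`). -/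
def B136h14 : Design := shiftD 5 B136

theorem B136h14_lists : B136h14.N = shB DN ∧ B136h14.P = shB B0 ++ shB B1 ++ shB B2 ++ shB B3 := by
  constructor
  · rfl
  · show DP.map (fun cm => (shiftCell 5 cm.1, cm.2)) = _
    rw [DP_eq_blocks]
    simp only [shB, List.map_append]

/-- (E1)–(E3) at h = 14. [kernel] -/
theorem structure_h14 :
    allB (shB DN) (fun cn => allB (shB DN) (fun cn' => cellEqB cn.1 cn'.1 || !ext1B cn.1 cn'.1)) = true ∧
    allB [(shB B0, shB B1 ++ shB B2 ++ shB B3), (shB B1, shB B0 ++ shB B2 ++ shB B3), (shB B2, shB B0 ++ shB B1 ++ shB B3),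
          (shB B3, shB B0 ++ shB B1 ++ shB B2)]
      (fun bb => allB bb.1 (fun s => allB bb.2 (fun s' =>
        !homB s.1 s'.1 && !ext1B s.1 s'.1 && !homB s'.1 s.1 && !ext1B s'.1 s.1))) = true ∧
    allB (shB B0) (fun s => !homB s.1 (shiftCell 5 tau0) && !homB s.1 (shiftCell 5 tau1) && !homB s.1 (shiftCell 5 tau2) &&
      (homB s.1 (shiftCell 5 tau3) == cellEqB s.1 (shiftCell 5 pi0))) = true ∧
    allB (shB B1) (fun s => !homB s.1 (shiftCell 5 tau1) && !homB s.1 (shiftCell 5 tau2) && !homB s.1 (shiftCell 5 tau3) &&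
      (homB s.1 (shiftCell 5 tau0) == cellEqB s.1 (shiftCell 5 pi1))) = true ∧
    allB (shB B2) (fun s => !homB s.1 (shiftCell 5 tau2) && !homB s.1 (shiftCell 5 tau3) && !homB s.1 (shiftCell 5 tau0) &&
      (homB s.1 (shiftCell 5 tau1) == cellEqB s.1 (shiftCell 5 pi2))) = true ∧
    allB (shB B3) (fun s => !homB s.1 (shiftCell 5 tau3) && !homB s.1 (shiftCell 5 tau0) && !homB s.1 (shiftCell 5 tau1) &&
      (homB s.1 (shiftCell 5 tau2) == cellEqB s.1 (shiftCell 5 pi3))) = true ∧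
    allB (shB DP) (fun s => homB s.1 (shiftCell 5 hub4) && !ext1B s.1 (shiftCell 5 hub4)) = true := by
  decide +kernel

/-- (E6) at h = 14: the same ample classes, thresholds moved by `20·a₀`. [kernel] -/
theorem slope_violations_h14 :
    allB [((7 : ℕ), (⟨6, -5, 2⟩ : Letter), (224 : ℤ)), (8, ⟨3, -2, 2⟩, 92), (9, ⟨3, -2, 1⟩, 104), (10, ⟨2, -1, 1⟩, 60), (11, ⟨2, -1, 1⟩, 60),
          (12, ⟨2, -1, 0⟩, 80), (13, ⟨2, -1, 0⟩, 72), (14, ⟨2, -1, 0⟩, 72), (15, ⟨2, -1, 0⟩, 72), (16, ⟨2, -1, 0⟩, 72)]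
      (fun c => slopeCert (shB B0) (shiftCell 5 tau3) c.1 c.2.1 c.2.2) = true ∧
    allB [((7 : ℕ), (⟨6, -3, -5⟩ : Letter), (212 : ℤ)), (8, ⟨3, -2, -2⟩, 92), (9, ⟨3, -2, -2⟩, 92), (10, ⟨2, -1, -1⟩, 60), (11, ⟨2, -1, -1⟩, 60),
          (12, ⟨2, -1, -1⟩, 60), (13, ⟨2, -1, -1⟩, 60), (14, ⟨2, -1, -1⟩, 60), (15, ⟨2, -1, -1⟩, 60), (16, ⟨2, -1, -1⟩, 60)]
      (fun c => slopeCert (shB B1) (shiftCell 5 tau0) c.1 c.2.1 c.2.2) = true ∧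
    allB [((7 : ℕ), (⟨6, 5, -3⟩ : Letter), (212 : ℤ)), (8, ⟨3, 2, -2⟩, 92), (9, ⟨3, 2, -2⟩, 92), (10, ⟨2, 1, -1⟩, 60), (11, ⟨2, 1, -1⟩, 60),
          (12, ⟨2, 1, -1⟩, 60), (13, ⟨2, 0, -1⟩, 56), (14, ⟨2, 0, -1⟩, 56), (15, ⟨2, 0, -1⟩, 56), (16, ⟨2, 0, -1⟩, 56)]
      (fun c => slopeCert (shB B2) (shiftCell 5 tau1) c.1 c.2.1 c.2.2) = true ∧
    allB [((7 : ℕ), (⟨6, 2, 5⟩ : Letter), (224 : ℤ)), (8, ⟨3, 2, 2⟩, 92), (9, ⟨3, 1, 2⟩, 104), (10, ⟨2, 1, 1⟩, 60), (11, ⟨2, 1, 1⟩, 60),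
          (12, ⟨2, 0, 1⟩, 80), (13, ⟨2, 0, 1⟩, 72), (14, ⟨2, 0, 1⟩, 72), (15, ⟨2, 0, 1⟩, 72), (16, ⟨2, 0, 1⟩, 72)]
      (fun c => slopeCert (shB B3) (shiftCell 5 tau2) c.1 c.2.1 c.2.2) = true := by
  decide +kernel

/-- **(E4)+(E6) arithmetic**: four blocks of generic rank ≤ 6 each cannot supply the `64 − 8 = 56` dimensions that must survive modulo the hub. -/
theorem rank_budget : ¬ (56 ≤ 4 * 6) := by decide

end Summit.HodgeConjecture.HodgeConjecture.Cruxes.BlochSeedDiscOne.ExtHallB136
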